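import Mathlib
import HarnessLib
import Literature.Probability.MarkovChains.BirthDeathChain
import Literature.Probability.MarkovChains.RandomTargetLemma

/-!
# Hitting times of birth-and-death chains: `E_{ℓ−1}(τ_ℓ) = (1/(q_ℓ w_ℓ)) Σ_{j<ℓ} w_j` (Levin–Peres–Wilmer §2.5, eq. (2.13)–(2.14))

HONEST FRAMING: exact (Metropolis-corrected) sampling algorithms for lattice gauge theory; figures
of merit are autocorrelation/cost numbers at stated couplings and volumes; no continuum-physics claim.

Source: D. A. Levin, Y. Peres (with E. L. Wilmer), *Markov Chains and Mixing Times*, 2nd ed.,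
AMS 2017 [LevinPeres2017], §2.5 "Birth-and-Death Chains", pp. 26–27: eq. (2.13)
(`E_{ℓ−1}(τ_ℓ) = (1/(q_ℓ w_ℓ)) Σ_{j=0}^{ℓ−1} w_j`), the display "To find `E_a(τ_b)` for `a < b`, just
sum: `E_a(τ_b) = Σ_{ℓ=a+1}^{b} E_{ℓ−1}(τ_ℓ)`", and the two special cases with constant rates
(`E_{ℓ−1}(τ_ℓ) = (1/(p − q))[1 − (q/p)^ℓ]`, eq. (2.14) for `E_0(τ_n)`, and `E_{ℓ−1}(τ_ℓ) = ℓ/p` when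
`p = q`).  Conventions of `BirthDeathChain.lean` (`bdKernel n p q` on `Fin (n+1)`, the weights
`bdWeight p q k = w_k = Π_{i<k} p_i/q_{i+1}`, `bdWeight_balance`: `p_k w_k = q_{k+1} w_{k+1}`) and
`RandomTargetLemma.lean` (`IsHittingTimeSolution P h`: the first-step equations `h(x,x) = 0`,
`h(a,x) = 1 + Σ_y P(a,y)h(y,x)` (`a ≠ x`) characterising `h(a,x) = E_a(τ_x)`, eq. (10.3)).
Everything is PROVED (0 named facts, 0 definitions); this fills the "NOT here" list of
`BirthDeathChain.lean` ((2.13) and its consequences) at the level of the first-step equations.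

DECLARED DEVIATION.  The book derives (2.13) from the return-time identity (Prop. 1.19) for the chain
truncated at `ℓ` ((2.11)–(2.12)) and the sum formula from the skip-free structure of the paths.  Here
both are read off the first-step equations directly: for a target `b` and a state `k < b` they say
`p_k [h(k,b) − h(k+1,b)] = 1 + q_k [h(k−1,b) − h(k,b)]` (`firstStep_sub`), so the one-step differences
`Δ_k = h(k−1,b) − h(k,b)` obey `q_k w_k Δ_k = Σ_{j<k} w_j` whatever the target `b ≥ k`
(`weight_mul_sub_eq_sum`, induction on `k` with `p_{k−1}w_{k−1} = q_k w_k`); taking `b = ℓ` gives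
(2.13) and telescoping gives the sum formula.  States below the target only are involved, so the top
boundary condition `p_n = 0` is never used; `q_0 = 0` is.

* `sum_bdKernel_mul` — `Σ_j P(k,j)f(j) = p_k f(k+1) + q_k f(k−1) + r_k f(k)` for `k < n` (with
  `q_0 = 0`) [cite: LevinPeres2017, §2.5 (definition of the chain)];
* `firstStep_sub`, `weight_mul_sub_eq_sum` — the two steps above [cite: LevinPeres2017, §2.5,
  derivation of (2.13)];
* **EQ. (2.13)** `LevinPeres2017_eq_2_13` — `q_ℓ w_ℓ E_{ℓ−1}(τ_ℓ) = Σ_{j=0}^{ℓ−1} w_j` (stated for the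
  lower state `i = ℓ − 1 : Fin n`), and the divided form `LevinPeres2017_eq_2_13_div`
  [cite: LevinPeres2017, §2.5 eq. (2.13)];
* **the sum formula** `LevinPeres2017_sec_2_5_sum` — `E_a(τ_b) = Σ_{a ≤ i < b} E_i(τ_{i+1})` for
  `a ≤ b` (irreducible parameters: `p_k ≠ 0` below `n`, `q_k ≠ 0` above `0`) [cite: LevinPeres2017,
  §2.5 ("To find `E_a(τ_b)` for `a < b`, just sum")];
* **constant rates** (`(q_k,r_k,p_k) = (q,r,p)` for `1 ≤ k < n`, `q_0 = 0`, `p_0 = p`, `q_n = q`):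
  `bdWeight_const` (`w_k = (p/q)^k`), `LevinPeres2017_sec_2_5_const` (`p ≠ q`:
  `E_{ℓ−1}(τ_ℓ) = [1 − (q/p)^ℓ]/(p − q)`), **EQ. (2.14)** `LevinPeres2017_eq_2_14`
  (`E_0(τ_n) = (1/(p−q))[n − q(1 − (q/p)^n)/(p − q)]`) and `LevinPeres2017_sec_2_5_const_eq` (`p = q`:
  `E_{ℓ−1}(τ_ℓ) = ℓ/p`) [cite: LevinPeres2017, §2.5 eq. (2.14) and the surrounding displays].
NOT CLAIMED: the identification `h(a,b) = E_a(τ_b)` on the trajectory space and the truncation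
argument (2.11)–(2.12) itself.

Context (cell pub-lqcd): the expected time for a one-dimensional order-parameter ladder (topological
charge / magnetisation moved by ±1 per accepted update) to climb from sector `a` to sector `b` is
exactly computable from the up/down rates — the elementary model behind "tunnelling time" figures.
-/

namespace Literature.Probability.MarkovChains

open Finset

variable {n : ℕ} {p q : ℕ → ℝ}

/-! ## One row of the kernel against a function -/

/-- `Σ_j P(k,j) f(j) = p_k f(k+1) + q_k f(k−1) + r_k f(k)` for a state `k < n` (the lower state
`k : Fin n` embedded by `castSucc`; at `k = 0` the middle term vanishes because `q_0 = 0`).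
[cite: LevinPeres2017, §2.5 (definition of a birth-and-death chain)] -/
theorem sum_bdKernel_mul (hq0 : q 0 = 0) (i : Fin n) (f : Fin (n + 1) → ℝ) :
    ∑ j, bdKernel n p q i.castSucc j * f j =
      p i.val * f i.succ + q i.val * f ⟨i.val - 1, by omega⟩ +
        (1 - p i.val - q i.val) * f i.castSucc := by
  have hi := i.isLt
  simp_rw [bdKernel_apply_eq_add, add_mul, sum_add_distrib, ite_mul, zero_mul, Fin.val_castSucc]
  have h1 : ∑ j : Fin (n + 1), (if j.val = i.val + 1 then p i.val * f j else 0) =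
      p i.val * f i.succ := by
    rw [Finset.sum_eq_single i.succ (fun j _ hj => if_neg fun h => hj (Fin.ext (by
      rw [Fin.val_succ]; exact h))) (fun h => absurd (mem_univ _) h), if_pos (Fin.val_succ i)]
  have h2 : ∑ j : Fin (n + 1), (if i.val = j.val + 1 then q i.val * f j else 0) =
      q i.val * f ⟨i.val - 1, by omega⟩ := by
    by_cases h0 : i.val = 0
    · have hq : q i.val = 0 := by rw [h0]; exact hq0
      rw [hq, zero_mul]
      exact sum_eq_zero fun j _ => by rw [if_neg (by omega)]
    · rw [Finset.sum_eq_single (⟨i.val - 1, by omega⟩ : Fin (n + 1)) (fun j _ hj => if_neg fun h => hj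
        (Fin.ext (by simp only; omega))) (fun h => absurd (mem_univ _) h), if_pos (by simp only; omega)]
  have h3 : ∑ j : Fin (n + 1), (if i.castSucc = j then (1 - p i.val - q i.val) * f j else 0) =
      (1 - p i.val - q i.val) * f i.castSucc := by
    rw [sum_ite_eq univ i.castSucc, if_pos (mem_univ _)]
  rw [h1, h2, h3]

/-! ## The first-step equations below the target -/

section Hitting

variable {h : Fin (n + 1) → Fin (n + 1) → ℝ}

/-- The first-step equation at a state `k < b`, rearranged:
`p_k [h(k,b) − h(k+1,b)] = 1 + q_k [h(k−1,b) − h(k,b)]`. [cite: LevinPeres2017, §2.5 (derivation of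
(2.13)); §10.2 eq. (10.3)] -/
theorem firstStep_sub (hh : IsHittingTimeSolution (bdKernel n p q) h) (hq0 : q 0 = 0)
    (b : Fin (n + 1)) (i : Fin n) (hib : i.val < b.val) :
    p i.val * (h i.castSucc b - h i.succ b) =
      1 + q i.val * (h ⟨i.val - 1, by omega⟩ b - h i.castSucc b) := by
  have hne : i.castSucc ≠ b := fun e => by rw [← e, Fin.val_castSucc] at hib; exact lt_irrefl _ hib
  have e := hh.off_diag hne
  rw [sum_bdKernel_mul hq0 i (fun j => h j b)] at e
  linear_combination e

/-- **`q_k w_k Δ_k = Σ_{j<k} w_j`** for the one-step differences `Δ_k = h(k−1,b) − h(k,b)` below any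
target `b ≥ k` (induction on `k` with `p_{k−1}w_{k−1} = q_k w_k`; stated with `k = m + 1`).
[cite: LevinPeres2017, §2.5 eq. (2.13) (derivation)] -/
theorem weight_mul_sub_eq_sum (hh : IsHittingTimeSolution (bdKernel n p q) h) (hq0 : q 0 = 0)
    (hq : ∀ k, 1 ≤ k → k ≤ n → q k ≠ 0) (b : Fin (n + 1)) :
    ∀ (m : ℕ) (hm : m < n), m < b.val →
      q (m + 1) * bdWeight p q (m + 1) *
          (h (Fin.castSucc ⟨m, hm⟩) b - h (Fin.succ ⟨m, hm⟩) b) =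
        ∑ j ∈ range (m + 1), bdWeight p q j := by
  intro m
  induction m with
  | zero =>
    intro hm hmb
    have e := firstStep_sub hh hq0 b ⟨0, hm⟩ hmb
    dsimp only at e
    have hb := bdWeight_balance (p := p) (k := 0) (hq 1 le_rfl (by omega))
    rw [bdWeight_zero, mul_one] at hb
    simp only [hq0, zero_mul, add_zero] at e
    rw [sum_range_one, bdWeight_zero, ← hb, e]
  | succ m ih =>
    intro hm hmb
    have ih' := ih (by omega) (by omega)
    have e := firstStep_sub hh hq0 b ⟨m + 1, hm⟩ hmb
    dsimp only at e
    have hb := bdWeight_balance (p := p) (k := m + 1) (hq (m + 2) (by omega) (by omega))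
    have e1 : (⟨m + 1 - 1, by omega⟩ : Fin (n + 1)) = Fin.castSucc ⟨m, by omega⟩ :=
      Fin.ext (by simp)
    have e2 : Fin.castSucc (⟨m + 1, hm⟩ : Fin n) = Fin.succ ⟨m, by omega⟩ := Fin.ext (by simp)
    rw [e1, e2] at e
    rw [e2, sum_range_succ, ← ih']
    linear_combination (-(h (Fin.succ ⟨m, by omega⟩) b - h (Fin.succ ⟨m + 1, hm⟩) b)) * hb +
      bdWeight p q (m + 1) * e

/-- **EQ. (2.13): `q_ℓ w_ℓ E_{ℓ−1}(τ_ℓ) = Σ_{j=0}^{ℓ−1} w_j`** (`ℓ = i + 1` for the lower state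
`i : Fin n`; death rates `q_k ≠ 0` for `1 ≤ k ≤ n`, `q_0 = 0`). [cite: LevinPeres2017, §2.5
eq. (2.13)] -/
theorem LevinPeres2017_eq_2_13 (hh : IsHittingTimeSolution (bdKernel n p q) h) (hq0 : q 0 = 0)
    (hq : ∀ k, 1 ≤ k → k ≤ n → q k ≠ 0) (i : Fin n) :
    q (i.val + 1) * bdWeight p q (i.val + 1) * h i.castSucc i.succ =
      ∑ j ∈ range (i.val + 1), bdWeight p q j := by
  have key := weight_mul_sub_eq_sum hh hq0 hq i.succ i.val i.isLt (by rw [Fin.val_succ]; omega)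
  simp only [Fin.eta, hh.diag, sub_zero] at key
  exact key

/-- `w_k ≠ 0` for `k ≤ n` when `p_k ≠ 0` below `n` and `q_k ≠ 0` above `0`.
[cite: LevinPeres2017, §2.5, proof of Prop. 2.8] -/
theorem bdWeight_ne_zero (hp : ∀ k, k < n → p k ≠ 0) (hq : ∀ k, 1 ≤ k → k ≤ n → q k ≠ 0) {k : ℕ}
    (hk : k ≤ n) : bdWeight p q k ≠ 0 :=
  prod_ne_zero_iff.2 fun i hi => by
    have := mem_range.1 hi
    exact div_ne_zero (hp i (by omega)) (hq (i + 1) (by omega) (by omega))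

/-- **EQ. (2.13), divided form: `E_{ℓ−1}(τ_ℓ) = (1/(q_ℓ w_ℓ)) Σ_{j=0}^{ℓ−1} w_j`.**
[cite: LevinPeres2017, §2.5 eq. (2.13)] -/
theorem LevinPeres2017_eq_2_13_div (hh : IsHittingTimeSolution (bdKernel n p q) h) (hq0 : q 0 = 0)
    (hp : ∀ k, k < n → p k ≠ 0) (hq : ∀ k, 1 ≤ k → k ≤ n → q k ≠ 0) (i : Fin n) :
    h i.castSucc i.succ =
      (∑ j ∈ range (i.val + 1), bdWeight p q j) / (q (i.val + 1) * bdWeight p q (i.val + 1)) := by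
  have hqw : q (i.val + 1) * bdWeight p q (i.val + 1) ≠ 0 :=
    mul_ne_zero (hq _ (by omega) (by omega)) (bdWeight_ne_zero hp hq (by omega))
  rw [eq_div_iff hqw, mul_comm, LevinPeres2017_eq_2_13 hh hq0 hq i]

/-- **"To find `E_a(τ_b)` for `a < b`, just sum: `E_a(τ_b) = Σ_{ℓ=a+1}^{b} E_{ℓ−1}(τ_ℓ)`"** — here
`h(a,b) = Σ_{a ≤ i < b} h(i, i+1)` for `a ≤ b` (irreducible parameters). [cite: LevinPeres2017, §2.5
(display after (2.13))] -/
theorem LevinPeres2017_sec_2_5_sum (hh : IsHittingTimeSolution (bdKernel n p q) h) (hq0 : q 0 = 0)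
    (hp : ∀ k, k < n → p k ≠ 0) (hq : ∀ k, 1 ≤ k → k ≤ n → q k ≠ 0) {a b : Fin (n + 1)}
    (hab : a ≤ b) :
    h a b = ∑ i : Fin n, if a.val ≤ i.val ∧ i.val < b.val then h i.castSucc i.succ else 0 := by
  have hbn := b.isLt
  have hab' : a.val ≤ b.val := hab
  -- the hitting times of `b` along `ℕ`
  set G : ℕ → ℝ := fun m => if hm : m < n + 1 then h ⟨m, hm⟩ b else 0 with hG
  -- one-step differences do not depend on the target
  have hstep : ∀ i : Fin n, i.val < b.val → G i.val - G (i.val + 1) = h i.castSucc i.succ := by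
    intro i hib
    have k1 := weight_mul_sub_eq_sum hh hq0 hq b i.val i.isLt hib
    have k2 := LevinPeres2017_eq_2_13 hh hq0 hq i
    have hqw : q (i.val + 1) * bdWeight p q (i.val + 1) ≠ 0 :=
      mul_ne_zero (hq _ (by omega) (by omega)) (bdWeight_ne_zero hp hq (by omega))
    have hGi : G i.val = h i.castSucc b := by
      simp only [hG, dif_pos (show i.val < n + 1 by omega)]; rfl
    have hGi1 : G (i.val + 1) = h i.succ b := by
      simp only [hG, dif_pos (show i.val + 1 < n + 1 by omega)]; rfl
    rw [hGi, hGi1]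
    simp only [Fin.eta] at k1
    exact mul_left_cancel₀ hqw (by rw [k1, k2])
  -- rewrite the `Fin n`-sum as a sum over `Ico a b ⊆ range n` and telescope
  have hsum : (∑ i : Fin n, if a.val ≤ i.val ∧ i.val < b.val then h i.castSucc i.succ else 0) =
      ∑ m ∈ range n, if a.val ≤ m ∧ m < b.val then G m - G (m + 1) else 0 := by
    rw [← Fin.sum_univ_eq_sum_range (fun m => if a.val ≤ m ∧ m < b.val then G m - G (m + 1) else 0)]
    refine sum_congr rfl fun i _ => ?_
    by_cases hc : a.val ≤ i.val ∧ i.val < b.val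
    · rw [if_pos hc, if_pos hc, hstep i hc.2]
    · rw [if_neg hc, if_neg hc]
  rw [hsum, ← sum_filter]
  have hfilter : (range n).filter (fun m => a.val ≤ m ∧ m < b.val) = Ico a.val b.val := by
    ext m
    simp only [mem_filter, mem_range, mem_Ico]
    omega
  rw [hfilter, sum_Ico_eq_sum_range]
  have htel : ∑ k ∈ range (b.val - a.val), (G (a.val + k) - G (a.val + k + 1)) =
      G a.val - G b.val := by
    have key := Finset.sum_range_sub' (fun k => G (a.val + k)) (b.val - a.val)
    rw [add_zero, Nat.add_sub_cancel' hab'] at key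
    rw [← key]
    exact sum_congr rfl fun k _ => by rw [add_assoc]
  have hGa : G a.val = h a b := by
    simp only [hG, dif_pos a.isLt, Fin.eta]
  have hGb : G b.val = 0 := by
    simp only [hG, dif_pos b.isLt, Fin.eta, hh.diag]
  rw [htel, hGa, hGb, sub_zero]

/-! ## Constant rates: `(q_k, r_k, p_k) = (q, r, p)` -/

/-- For constant rates (`p_k = p` for `k < n`, `q_k = q` for `1 ≤ k ≤ n`), `w_k = (p/q)^k`
(`k ≤ n`). [cite: LevinPeres2017, §2.5 ("We have `w_k = (p/q)^k` for `0 ≤ k ≤ n`")] -/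
theorem bdWeight_const {p₀ q₀ : ℝ} (hpk : ∀ k, k < n → p k = p₀) (hqk : ∀ k, 1 ≤ k → k ≤ n → q k = q₀) :
    ∀ k, k ≤ n → bdWeight p q k = (p₀ / q₀) ^ k := by
  intro k
  induction k with
  | zero => intro; rw [bdWeight_zero, pow_zero]
  | succ k ih =>
    intro hk
    rw [bdWeight_succ, ih (by omega), hpk k (by omega), hqk (k + 1) (by omega) hk, pow_succ]

/-- **Constant rates, `p ≠ q`: `E_{ℓ−1}(τ_ℓ) = (1/(p − q))[1 − (q/p)^ℓ]`** (`ℓ = i + 1`).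
[cite: LevinPeres2017, §2.5 (display before (2.14))] -/
theorem LevinPeres2017_sec_2_5_const (hh : IsHittingTimeSolution (bdKernel n p q) h) {p₀ q₀ : ℝ}
    (hp0 : p₀ ≠ 0) (hq0' : q₀ ≠ 0) (hpq : p₀ ≠ q₀) (hq0 : q 0 = 0) (hpk : ∀ k, k < n → p k = p₀)
    (hqk : ∀ k, 1 ≤ k → k ≤ n → q k = q₀) (i : Fin n) :
    h i.castSucc i.succ = (1 - (q₀ / p₀) ^ (i.val + 1)) / (p₀ - q₀) := by
  have hq : ∀ k, 1 ≤ k → k ≤ n → q k ≠ 0 := fun k h1 h2 => by rw [hqk k h1 h2]; exact hq0'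
  have key := LevinPeres2017_eq_2_13 hh hq0 hq i
  rw [hqk _ (by omega) (by omega), bdWeight_const hpk hqk _ (by omega),
    sum_congr rfl fun j hj => bdWeight_const hpk hqk j (by have := mem_range.1 hj; omega),
    geom_sum_eq (by intro e; exact hpq (by field_simp at e; linarith)) (i.val + 1)] at key
  have hx : (p₀ / q₀) ^ (i.val + 1) ≠ 0 := pow_ne_zero _ (div_ne_zero hp0 hq0')
  have hpq' : p₀ - q₀ ≠ 0 := sub_ne_zero.2 hpq
  have hx1 : p₀ / q₀ - 1 ≠ 0 := by
    intro e; exact hpq (by field_simp at e; linarith)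
  rw [eq_div_iff hpq']
  have e2 : q₀ * (p₀ / q₀) ^ (i.val + 1) * h i.castSucc i.succ * (p₀ / q₀ - 1) =
      (p₀ / q₀) ^ (i.val + 1) - 1 := by
    rw [key, div_mul_cancel₀ _ hx1]
  have e3 : (q₀ / p₀) ^ (i.val + 1) * (p₀ / q₀) ^ (i.val + 1) = 1 := by
    rw [← mul_pow, div_mul_div_comm, mul_comm q₀ p₀, div_self (mul_ne_zero hp0 hq0'), one_pow]
  have e4 : q₀ * (p₀ / q₀ - 1) = p₀ - q₀ := by
    rw [mul_sub, mul_div_cancel₀ _ hq0', mul_one]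
  -- multiply the goal by `x^{ℓ} ≠ 0`
  apply mul_right_cancel₀ hx
  calc h i.castSucc i.succ * (p₀ - q₀) * (p₀ / q₀) ^ (i.val + 1)
      = q₀ * (p₀ / q₀) ^ (i.val + 1) * h i.castSucc i.succ * (p₀ / q₀ - 1) := by
        rw [← e4]; ring
    _ = (p₀ / q₀) ^ (i.val + 1) - 1 := e2
    _ = (1 - (q₀ / p₀) ^ (i.val + 1)) * (p₀ / q₀) ^ (i.val + 1) := by
        rw [sub_mul, one_mul, e3]

/-- **EQ. (2.14): `E_0(τ_n) = (1/(p − q))[n − q(1 − (q/p)^n)/(p − q)]`** for constant rates with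
`p ≠ q`. [cite: LevinPeres2017, §2.5 eq. (2.14)] -/
theorem LevinPeres2017_eq_2_14 (hh : IsHittingTimeSolution (bdKernel n p q) h) {p₀ q₀ : ℝ}
    (hp0 : p₀ ≠ 0) (hq0' : q₀ ≠ 0) (hpq : p₀ ≠ q₀) (hq0 : q 0 = 0) (hpk : ∀ k, k < n → p k = p₀)
    (hqk : ∀ k, 1 ≤ k → k ≤ n → q k = q₀) :
    h 0 (Fin.last n) = (1 / (p₀ - q₀)) * (n - q₀ * ((1 - (q₀ / p₀) ^ n) / (p₀ - q₀))) := by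
  have hp : ∀ k, k < n → p k ≠ 0 := fun k hk => by rw [hpk k hk]; exact hp0
  have hq : ∀ k, 1 ≤ k → k ≤ n → q k ≠ 0 := fun k h1 h2 => by rw [hqk k h1 h2]; exact hq0'
  rw [LevinPeres2017_sec_2_5_sum hh hq0 hp hq (Fin.zero_le _)]
  have hs : (∑ i : Fin n, if (0 : Fin (n + 1)).val ≤ i.val ∧ i.val < (Fin.last n).val then
      h i.castSucc i.succ else 0) = ∑ i : Fin n, (1 - (q₀ / p₀) ^ (i.val + 1)) / (p₀ - q₀) := by
    refine sum_congr rfl fun i _ => ?_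
    rw [if_pos ⟨Nat.zero_le _, by rw [Fin.val_last]; exact i.isLt⟩,
      LevinPeres2017_sec_2_5_const hh hp0 hq0' hpq hq0 hpk hqk i]
  rw [hs, Fin.sum_univ_eq_sum_range (fun m => (1 - (q₀ / p₀) ^ (m + 1)) / (p₀ - q₀)) n,
    ← sum_div, sum_sub_distrib, sum_const, card_range, nsmul_eq_mul, mul_one]
  have hy1 : q₀ / p₀ ≠ 1 := by
    intro e; exact hpq (by field_simp at e; linarith)
  have hgeom : ∑ m ∈ range n, (q₀ / p₀) ^ (m + 1) = q₀ * ((1 - (q₀ / p₀) ^ n) / (p₀ - q₀)) := by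
    simp_rw [pow_succ]
    rw [← sum_mul, geom_sum_eq hy1]
    have hpq' : p₀ - q₀ ≠ 0 := sub_ne_zero.2 hpq
    field_simp
    ring
  rw [hgeom]
  ring

/-- **Constant rates, `p = q`: `E_{ℓ−1}(τ_ℓ) = ℓ/p`** (`w_j = 1` for all `j`).
[cite: LevinPeres2017, §2.5 ("If `p = q`, then `w_j = 1` for all `j` and `E_{ℓ−1}(τ_ℓ) = ℓ/p`")] -/
theorem LevinPeres2017_sec_2_5_const_eq (hh : IsHittingTimeSolution (bdKernel n p q) h) {p₀ : ℝ}
    (hp0 : p₀ ≠ 0) (hq0 : q 0 = 0) (hpk : ∀ k, k < n → p k = p₀)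
    (hqk : ∀ k, 1 ≤ k → k ≤ n → q k = p₀) (i : Fin n) :
    h i.castSucc i.succ = (i.val + 1 : ℕ) / p₀ := by
  have hq : ∀ k, 1 ≤ k → k ≤ n → q k ≠ 0 := fun k h1 h2 => by rw [hqk k h1 h2]; exact hp0
  have key := LevinPeres2017_eq_2_13 hh hq0 hq i
  have hw : ∀ k, k ≤ n → bdWeight p q k = 1 := fun k hk => by
    rw [bdWeight_const hpk hqk k hk, div_self hp0, one_pow]
  rw [hqk _ (by omega) (by omega), hw _ (by omega), mul_one,
    sum_congr rfl fun j hj => hw j (by have := mem_range.1 hj; omega), sum_const, card_range,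
    nsmul_eq_mul, mul_one] at key
  rw [eq_div_iff hp0, mul_comm, key]

end Hitting

end Literature.Probability.MarkovChains
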